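import Summits.AtomisticToContinuum.Crystallization.Theorems.PhononSlackCertificatesPeriodicGivenLayeredMajorisation

/-!
# `PeriodicGivenLayered` (stmt-AtomisticToContinuum-11779), line `Sketch`, stub `stub_closing` — part 1

Hägg-word bookkeeping for the density closing (lead prover-line-stmt-AtomisticToContinuum-11779-0):

* `clo_haggAligned_two_iff` — layers `m, m+2` are aligned iff `s (m+1) = −s m` (no fault at `m`);
* reflection `n ↦ s (2m − 1 − n)`: the BACKWARD registry energy at `m` is the FORWARD energy of the
  reflected word (`clo_haggBackwardLocalEnergy_eq_reflect`), and the alternating word has the same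
  backward and forward alignment pattern (`clo_haggBackwardLocalEnergy_alternating`);
* consequences of the landed alternating majorisation
  (`LayeredHull.haggLocalEnergy_alternating_add_deficit_le`): the forward price
  `haggLocalEnergy J alt m + c₀·1[fault at m] ≤ haggLocalEnergy J s m` (`clo_forward_price`) and the
  backward inequality `haggBackwardLocalEnergy J alt m ≤ haggBackwardLocalEnergy J s m`
  (`clo_backward_le`), for couplings `J k ≤ 0` non-decreasing from `k = 2` on with `c₀ ≤ J 3 − J 2`;
* registry rewriting of free-height layer interactions: the interaction of a site of layer `m` with
  layer `m ± k` at height `H` is `Φ_N(H) + 1[aligned]·D(H)`, `D(H) = barlowCoupling V a H 1`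
  (`clo_layerInteraction_label_add`, `clo_layerInteraction_label_sub`), and evenness in the height
  (`clo_layerInteraction_neg_height`).
-/

noncomputable section

namespace Summit.AtomisticToContinuum.Crystallization.Theorems.LayeredHull

open scoped BigOperators
open Finset Filter Literature.MathematicalPhysics.StatisticalMechanics

variable {s : ℤ → ℤ} {J : ℕ → ℝ}

/-! ## Faults and alignment at distance two -/

/-- For a Hägg word, layers `m` and `m + 2` are aligned iff `s (m+1) = - s m` (the word alternates
at `m`, i.e. there is NO stacking fault at `m`). [folklore] -/
theorem clo_haggAligned_two_iff (hs : IsHaggSeq s) (m : ℤ) :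
    HaggAligned s m 2 ↔ s (m + 1) = -s m := by
  change haggWindow s m 2 % 3 = 0 ↔ _
  rw [haggWindow, sum_range_succ, sum_range_succ, sum_range_zero, zero_add]
  simp only [Nat.cast_zero, add_zero, Nat.cast_one]
  rcases hs m with h0 | h0 <;> rcases hs (m + 1) with h1 | h1 <;> rw [h0, h1] <;> decide

/-! ## Reflection of a word about a layer -/

/-- The reflected word `n ↦ s (2m − 1 − n)` is a Hägg word. [folklore] -/
theorem clo_isHaggSeq_reflect (hs : IsHaggSeq s) (m : ℤ) :
    IsHaggSeq fun n => s (2 * m - 1 - n) := fun _ => hs _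

/-- Windows of the reflected word: the forward window of length `k` at `m` of `n ↦ s (2m−1−n)` is
the window of `s` on `[m − k, m)`. [folklore] -/
theorem clo_haggWindow_reflect (s : ℤ → ℤ) (m : ℤ) (k : ℕ) :
    haggWindow (fun n => s (2 * m - 1 - n)) m k = haggWindow s (m - k) k := by
  simp only [haggWindow]
  rw [← sum_range_reflect (fun i => s (m - k + i)) k]
  refine sum_congr rfl fun i hi => ?_
  have hi' : i < k := mem_range.1 hi
  congr 1
  have : ((k - 1 - i : ℕ) : ℤ) = (k : ℤ) - 1 - i := by
    rw [Nat.cast_sub (by omega), Nat.cast_sub (by omega)]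
    simp
  rw [this]
  ring

/-- Alignment of the reflected word at `m` is backward alignment of `s` at `m`. [folklore] -/
theorem clo_haggAligned_reflect (s : ℤ → ℤ) (m : ℤ) (k : ℕ) :
    HaggAligned (fun n => s (2 * m - 1 - n)) m k ↔ HaggAligned s (m - k) k := by
  change haggWindow _ m k % 3 = 0 ↔ haggWindow s (m - k) k % 3 = 0
  rw [clo_haggWindow_reflect]

/-- **The backward registry energy is the forward energy of the reflected word.** [folklore] -/
theorem clo_haggBackwardLocalEnergy_eq_reflect (J : ℕ → ℝ) (s : ℤ → ℤ) (m : ℤ) :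
    haggBackwardLocalEnergy J s m = haggLocalEnergy J (fun n => s (2 * m - 1 - n)) m := by
  unfold haggBackwardLocalEnergy haggLocalEnergy
  refine tsum_congr fun k => ?_
  simp only [clo_haggAligned_reflect]

/-- For the alternating word, backward and forward alignment at `m` agree (both mean `k` even).
[folklore] -/
theorem clo_haggAligned_alternating_sub (m : ℤ) (k : ℕ) :
    HaggAligned alternatingHagg (m - k) k ↔ HaggAligned alternatingHagg m k := by
  rw [haggAligned_alternating_iff, haggAligned_alternating_iff]

/-- Hence the backward registry energy of the alternating word equals its forward energy.
[folklore] -/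
theorem clo_haggBackwardLocalEnergy_alternating (J : ℕ → ℝ) (m : ℤ) :
    haggBackwardLocalEnergy J alternatingHagg m = haggLocalEnergy J alternatingHagg m := by
  unfold haggBackwardLocalEnergy haggLocalEnergy
  refine tsum_congr fun k => ?_
  simp only [clo_haggAligned_alternating_sub]

/-! ## Consequences of the alternating majorisation -/

/-- **Forward price of a fault.** For summable couplings `J k ≤ 0` non-decreasing from `k = 2` on
and `c₀ ≤ J 3 − J 2`, every Hägg word pays at least `c₀` at every fault against the alternating
word: `haggLocalEnergy J alt m + c₀·1[s (m+1) ≠ −s m] ≤ haggLocalEnergy J s m`. [folklore] -/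
theorem clo_forward_price (hs : IsHaggSeq s) (hJ : Summable J) (hJ0 : ∀ k, 2 ≤ k → J k ≤ 0)
    (hmono : ∀ k, 2 ≤ k → J k ≤ J (k + 1)) {c₀ : ℝ} (hc : c₀ ≤ J 3 - J 2) (m : ℤ) :
    haggLocalEnergy J alternatingHagg m + c₀ * (if s (m + 1) = -s m then (0 : ℝ) else 1) ≤
      haggLocalEnergy J s m := by
  have h := haggLocalEnergy_alternating_add_deficit_le hs hJ hJ0 hmono m
  have hind : (if HaggAligned s m 2 then (0 : ℝ) else 1) = if s (m + 1) = -s m then (0 : ℝ) else 1 := by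
    by_cases h2 : s (m + 1) = -s m
    · rw [if_pos ((clo_haggAligned_two_iff hs m).2 h2), if_pos h2]
    · rw [if_neg (fun h' => h2 ((clo_haggAligned_two_iff hs m).1 h')), if_neg h2]
  rw [hind] at h
  have hnn : (0 : ℝ) ≤ (if s (m + 1) = -s m then (0 : ℝ) else 1) := by split_ifs <;> norm_num
  nlinarith [mul_le_mul_of_nonneg_right hc hnn]

/-- **The backward inequality.** Under the same hypotheses on `J`, the backward registry energy of
every Hägg word is at least that of the alternating word (reflect and apply the majorisation with
the deficit dropped). [folklore] -/
theorem clo_backward_le (hs : IsHaggSeq s) (hJ : Summable J) (hJ0 : ∀ k, 2 ≤ k → J k ≤ 0)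
    (hmono : ∀ k, 2 ≤ k → J k ≤ J (k + 1)) (m : ℤ) :
    haggBackwardLocalEnergy J alternatingHagg m ≤ haggBackwardLocalEnergy J s m := by
  rw [clo_haggBackwardLocalEnergy_alternating, clo_haggBackwardLocalEnergy_eq_reflect J s m]
  have h := haggLocalEnergy_alternating_add_deficit_le (clo_isHaggSeq_reflect hs m) hJ hJ0 hmono m
  have h32 : 0 ≤ J 3 - J 2 := by linarith [hmono 2 le_rfl]
  have hnn : (0 : ℝ) ≤ (if HaggAligned (fun n => s (2 * m - 1 - n)) m 2 then (0 : ℝ) else 1) := by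
    split_ifs <;> norm_num
  nlinarith [mul_nonneg h32 hnn]

/-! ## Registry rewriting of free-height layer interactions -/

/-- `layerNormal (-h) = -layerNormal h`. [folklore] -/
theorem clo_layerNormal_neg (h : ℝ) : layerNormal (-h) = -layerNormal h := by
  ext i
  fin_cases i <;> simp [layerNormal]

/-- **The free-height layer interaction is even in the height**:
`layerInteraction V a (-H) δ 1 = layerInteraction V a H δ 1`. [folklore] -/
theorem clo_layerInteraction_neg_height (V : ℝ → ℝ) (a H : ℝ) (δ : ℤ) :
    layerInteraction V a (-H) δ 1 = layerInteraction V a H δ 1 := by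
  rw [← layerInteraction_neg_layer V a H δ 1]
  unfold layerInteraction
  refine tsum_congr fun ij => ?_
  congr 2
  simp only [layerVec, clo_layerNormal_neg, Int.cast_neg, Int.cast_one, neg_smul, one_smul, smul_neg]

/-- **Registry rewriting, layers above.** A site of layer `m` of the stacking coded by the word `s`
sees layer `m + k` (height `H`) as the triangular lattice offset by `L (m+k) − L m` letters: the
interaction is the non-aligned value `Φ_N(H)` plus `D(H) = barlowCoupling V a H 1` if the two layers
are aligned. [folklore] -/
theorem clo_layerInteraction_label_add (V : ℝ → ℝ) (a H : ℝ) (s : ℤ → ℤ) (m : ℤ) (k : ℕ) :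
    layerInteraction V a H (haggLabel s (m + k) - haggLabel s m) 1 =
      layerInteraction V a H 1 1 + if HaggAligned s m k then barlowCoupling V a H 1 else 0 := by
  have hL : haggLabel s (m + k) - haggLabel s m = haggWindow s m k := by
    rw [haggLabel_add_natCast]; ring
  rw [hL, layerInteraction_eq_ite]
  exact ite_layerInteraction_eq V a H (HaggAligned s m k) 1

/-- **Registry rewriting, layers below.** The same for layer `m − k`: offset `L (m−k) − L m`, aligned
iff `HaggAligned s (m − k) k`. [folklore] -/
theorem clo_layerInteraction_label_sub (V : ℝ → ℝ) (a H : ℝ) (s : ℤ → ℤ) (m : ℤ) (k : ℕ) :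
    layerInteraction V a H (haggLabel s (m - k) - haggLabel s m) 1 =
      layerInteraction V a H 1 1 + if HaggAligned s (m - k) k then barlowCoupling V a H 1 else 0 := by
  have hL : haggLabel s (m - k) - haggLabel s m = -haggWindow s (m - k) k := by
    have := haggLabel_add_natCast s (m - k) k
    rw [sub_add_cancel] at this
    rw [this]; ring
  rw [hL, layerInteraction_neg_offset, layerInteraction_eq_ite]
  exact ite_layerInteraction_eq V a H (HaggAligned s (m - k) k) 1

/-- Alignment at distance `0` always holds. [folklore] -/
theorem clo_haggAligned_zero (s : ℤ → ℤ) (m : ℤ) : HaggAligned s m 0 := by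
  change haggWindow s m 0 % 3 = 0
  rw [haggWindow_zero]; rfl

end Summit.AtomisticToContinuum.Crystallization.Theorems.LayeredHull

end
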